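import Summits.Ventures.AbcSig.Sieve.CharpolySieve
import Summits.Ventures.AbcSig.Levels.N9248

/-!
# Venture AbcSig — GENERATED norm-form (characteristic polynomial) kills, level 9248

HONEST FRAMING. Machine-generated by the p-lean seat's `gen3/cpgen.py` (exact arithmetic, untrusted; the kernel re-checks the
kills). For the listed orbits of `Levels/N9248.lean` and the listed exponents `n` — residual exponents that the `ℤ[θ]`-basis
sieve certificates cannot eliminate because `n` divides every eigenvalue denominator in that basis (index artefacts) — the
characteristic polynomial `P_ℓ` of `c_ℓ` on the orbit (computed from the engine-1 level file `N9248.engine1.json`, sha256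
`eabde318144a8cc3eae3723af1893bfef0344ca695b52c5dc78b812c9ed2404e`) has `n ∤ P_ℓ(t)` for every allowed trace `t`: the printed norm method of [BS04, Prop. 4.3]. COMPUTED hypothesis per
orbit: `RefinesCP` (the listed `P_ℓ` annihilate `c_ℓ` on the orbit); CITED: `BS04Package`. THEOREM per (orbit, n):
`cp_<N>_<k>_n<n>_excludes : BS04Package → RefinesCP → ExcludesStd` (`Sieve/CharpolySieve.lean`). No claim on ABC or any
summit; no Diophantine statement is made in this file.
-/

set_option maxRecDepth 100000

namespace Summit.Ventures.AbcSig

/-- Characteristic polynomials `P_ℓ` of `c_ℓ` on the orbit `orbit_9248_50` (engine-1 id `9248.50`, degree 16) at ℓ ∈ [3], computed exactly from the level file's θ-coordinates (Faddeev–LeVerrier; basis independent). -/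
def cp_9248_50 : List CPEntry := [⟨3, [35344, 0, -105280, 0, 126528, 0, -79200, 0, 27960, 0, -5680, 0, 656, 0, -40, 0, 1]⟩]

/-- Norm-form kill of the exponent 41 at ℓ = 3: `41 ∤ P_3(t)` for every `t ∈ bs04Allowed 3`. -/
theorem cp_9248_50_n41_kills : cpKills cp_9248_50 bs04Allowed 41 9248 = true := by decide +kernel

/-- **`orbit_9248_50` is excluded at exponent 41** ([BS04, Prop. 4.3] norm form in the kernel), modulo `BS04Package` and the COMPUTED `RefinesCP` (the characteristic polynomials belong to the orbit). -/
theorem cp_9248_50_n41_excludes (M : NewformModel) (hP : M.BS04Package) (hRef : M.RefinesCP 9248 orbit_9248_50 cp_9248_50) :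
    M.ExcludesStd 9248 orbit_9248_50 41 :=
  M.excludesStd_of_cpKills hP orbit_9248_50 cp_9248_50 hRef 41 cp_9248_50_n41_kills

/-- Norm-form kill of the exponent 116657 at ℓ = 3: `116657 ∤ P_3(t)` for every `t ∈ bs04Allowed 3`. -/
theorem cp_9248_50_n116657_kills : cpKills cp_9248_50 bs04Allowed 116657 9248 = true := by decide +kernel

/-- **`orbit_9248_50` is excluded at exponent 116657** ([BS04, Prop. 4.3] norm form in the kernel), modulo `BS04Package` and the COMPUTED `RefinesCP` (the characteristic polynomials belong to the orbit). -/
theorem cp_9248_50_n116657_excludes (M : NewformModel) (hP : M.BS04Package) (hRef : M.RefinesCP 9248 orbit_9248_50 cp_9248_50) :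
    M.ExcludesStd 9248 orbit_9248_50 116657 :=
  M.excludesStd_of_cpKills hP orbit_9248_50 cp_9248_50 hRef 116657 cp_9248_50_n116657_kills

end Summit.Ventures.AbcSig
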